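import Mathlib
import HarnessLib
import Literature.MathematicalPhysics.StatisticalMechanics.StrongNormExpLipschitz

/-!
# The exponential map into the strong norm has LIPSCHITZ FIRST DIFFERENCES ([ABKM19] Lemma 9.3,
# `D²E` bound, difference form): `|e^{−(H+Y+Z)(B)} − e^{−(H+Y)(B)} − e^{−(H+Z)(B)} + e^{−H(B)}|_{T_φ}
# ≤ 256 e^{1/4} ‖Y‖_{k,0}‖Z‖_{k,0} W(φ)`

Continuation of `StrongNormExpLipschitz.lean` (first differences: `16e^{3/8}‖H − H'‖`).  [ABKM19]
Lemma 9.3 states that `E(H) = e^{H}` is smooth from `(M_0, ‖·‖_{k,0})` into the strong norm with all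
derivatives bounded on a ball; the smoothness half of Theorem 2.2 (regular dependence of the tuned flow
on its data) consumes the SECOND derivative, in the tree in DIFFERENCE form: parallelogram second
differences.  Since `H ↦ H(B, φ)` is linear, the second difference of the exponential FACTORISES,
`e^{F+U+V} − e^{F+U} − e^{F+V} + e^{F} = e^{F}(e^{U} − 1)(e^{V} − 1)`, and the first-order mechanism
(product property, `‖e^G‖_{T_φ} ≤ e^{‖G‖}`, `‖e^D − 1‖_{T_φ} ≤ ‖D‖e^{‖D‖}`, `ℓ²` domination
`|H(B)|_{T_φ} ≤ 2(1+N(φ)²)‖H‖_{k,0}`, `(1+N²)² ≤ 64e^{N²/4}`, `e^{N²/2} ≤ W(φ)`) gives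

* **`tayNormLE_cexp_eval_secondDiff`** — for an `ℓ²`-dominating weight, `‖H‖_{k,0} ≤ 1/16`,
  `‖Y‖_{k,0}, ‖Z‖_{k,0} ≤ 1/32`: the bound `256e^{1/4}‖Y‖_{k,0}‖Z‖_{k,0}`;
* **`tayNormLE_cexp_neg_eval_secondDiff`** — the Boltzmann factors `e^{−H(B)}`;
* **`tayNormLE_expNegH_secondDiff_strong_abkm`** — the instantiation for the torus tower's strong
  weight `W_k^B`.

Everything is proved; no named fact.

## References
* S. Adams, S. Buchholz, R. Kotecký, S. Müller, arXiv:1910.13564, Lemma 9.3 ((9.13)–(9.16), the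
  bound on `D²E`) [AdamsBuchholzKoteckyMuller2019].
-/

noncomputable section

namespace Literature.MathematicalPhysics.StatisticalMechanics.GradientRG

open scoped BigOperators
open Finset
open Literature.MathematicalPhysics.QuantumFieldTheory
open Literature.MathematicalPhysics.StatisticalMechanics.TorusPolymer (blockOf)

variable {d M : ℕ} [NeZero M]

/-- `(1 + N²)² ≤ 64 e^{N²/4}`. [folklore] -/
private theorem one_add_sq_sq_le (N : ℝ) : (1 + N ^ 2) ^ 2 ≤ 64 * Real.exp (N ^ 2 / 4) := by
  have h1 : 1 + N ^ 2 ≤ 8 * Real.exp (N ^ 2 / 8) := by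
    have := Real.add_one_le_exp (N ^ 2 / 8)
    nlinarith [sq_nonneg N]
  have h0 : 0 ≤ 1 + N ^ 2 := by positivity
  have h2 := mul_le_mul h1 h1 h0 (by positivity)
  have e : 8 * Real.exp (N ^ 2 / 8) * (8 * Real.exp (N ^ 2 / 8)) = 64 * Real.exp (N ^ 2 / 4) := by
    rw [show N ^ 2 / 4 = N ^ 2 / 8 + N ^ 2 / 8 by ring, Real.exp_add]; ring
  rw [sq, ← e]
  exact h2

/-- **Second differences of `E` into the strong norm**: for an `ℓ²`-dominating weight `W`,
`‖H‖_{k,0} ≤ 1/16` and `‖Y‖_{k,0}, ‖Z‖_{k,0} ≤ 1/32`: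
`‖e^{(H+Y+Z)(B)} − e^{(H+Y)(B)} − e^{(H+Z)(B)} + e^{H(B)}‖_{T, W} ≤ 256e^{1/4}‖Y‖_{k,0}‖Z‖_{k,0}`.
[cite: AdamsBuchholzKoteckyMuller2019, Lemma 9.3 (9.13)] -/
theorem tayNormLE_cexp_eval_secondDiff {𝔥 R : ℝ} (h𝔥 : 0 < 𝔥) (hR : 0 < R) {p : ℕ}
    (hp : d / 2 + 1 ≤ p) {S B : Finset (Fin d → ZMod M)} (hBS : B ⊆ S)
    {W : ((Fin d → ZMod M) → ℝ) → ℝ} (hW : Ell2Dominates B 𝔥 R W) {H Y Z : RelevantHamiltonian ℂ d}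
    (r₀ : ℕ) (hH : hamNorm 𝔥 R B.card H ≤ 1 / 16) (hY : hamNorm 𝔥 R B.card Y ≤ 1 / 32)
    (hZ : hamNorm 𝔥 R B.card Z ≤ 1 / 32) :
    TayNormLE (fieldGauge 𝔥 R p S) r₀ W
      (fun ψ : (Fin d → ZMod M) → ℝ => Complex.exp (eval (H + Y + Z) B ψ) - Complex.exp (eval (H + Y) B ψ)
        - Complex.exp (eval (H + Z) B ψ) + Complex.exp (eval H B ψ))
      (256 * Real.exp (1 / 4) * hamNorm 𝔥 R B.card Y * hamNorm 𝔥 R B.card Z) := by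
  intro φ
  obtain ⟨N, hN0, hNlin, hNgrad, hNW⟩ := hW φ
  set T := fieldGauge 𝔥 R p S with hT
  set a := hamNorm 𝔥 R B.card Y with ha
  set b := hamNorm 𝔥 R B.card Z with hb
  have ha0 : 0 ≤ a := hamNorm_nonneg h𝔥.le hR.le _ _
  have hb0 : 0 ≤ b := hamNorm_nonneg h𝔥.le hR.le _ _
  -- the factorisation `e^{F+U+V} − e^{F+U} − e^{F+V} + e^F = e^F (e^U − 1)(e^V − 1)`
  have hfac : (fun ψ : (Fin d → ZMod M) → ℝ => Complex.exp (eval (H + Y + Z) B ψ) - Complex.exp (eval (H + Y) B ψ)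
        - Complex.exp (eval (H + Z) B ψ) + Complex.exp (eval H B ψ)) =
      ((fun ψ => Complex.exp (eval H B ψ)) * fun ψ => Complex.exp (eval Y B ψ) - 1) *
        fun ψ => Complex.exp (eval Z B ψ) - 1 := by
    funext ψ
    simp only [Pi.mul_apply, eval_add]
    rw [Complex.exp_add, Complex.exp_add, Complex.exp_add]
    ring
  rw [hfac]
  have hFd : ContDiff ℝ r₀ (fun ψ : (Fin d → ZMod M) → ℝ => Complex.exp (eval H B ψ)) :=
    (contDiff_eval H B).cexp
  have hUd : ContDiff ℝ r₀ (fun ψ : (Fin d → ZMod M) → ℝ => Complex.exp (eval Y B ψ) - 1) :=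
    (contDiff_eval Y B).cexp.sub contDiff_const
  have hVd : ContDiff ℝ r₀ (fun ψ : (Fin d → ZMod M) → ℝ => Complex.exp (eval Z B ψ) - 1) :=
    (contDiff_eval Z B).cexp.sub contDiff_const
  have hFUd : ContDiff ℝ r₀ ((fun ψ : (Fin d → ZMod M) → ℝ => Complex.exp (eval H B ψ)) *
      fun ψ => Complex.exp (eval Y B ψ) - 1) := hFd.mul hUd
  set nF := tayNorm T r₀ (fun ψ : (Fin d → ZMod M) → ℝ => Complex.exp (eval H B ψ)) φ with hnF
  set nU := tayNorm T r₀ (fun ψ : (Fin d → ZMod M) → ℝ => Complex.exp (eval Y B ψ) - 1) φ with hnU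
  set nV := tayNorm T r₀ (fun ψ : (Fin d → ZMod M) → ℝ => Complex.exp (eval Z B ψ) - 1) φ with hnV
  have hnF0 : 0 ≤ nF := tayNorm_nonneg _ _ _ _
  have hnU0 : 0 ≤ nU := tayNorm_nonneg _ _ _ _
  have hnV0 : 0 ≤ nV := tayNorm_nonneg _ _ _ _
  have hstep1 := tayNorm_mul_le T hFUd hVd φ
  have hstep2 : tayNorm T r₀ ((fun ψ : (Fin d → ZMod M) → ℝ => Complex.exp (eval H B ψ)) *
      fun ψ => Complex.exp (eval Y B ψ) - 1) φ ≤ nF * nU := tayNorm_mul_le T hFd hUd φ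
  have hstep : tayNorm T r₀ (((fun ψ : (Fin d → ZMod M) → ℝ => Complex.exp (eval H B ψ)) *
      fun ψ => Complex.exp (eval Y B ψ) - 1) * fun ψ => Complex.exp (eval Z B ψ) - 1) φ ≤ nF * nU * nV :=
    hstep1.trans (mul_le_mul_of_nonneg_right hstep2 hnV0)
  refine hstep.trans ?_
  -- the three factors
  set tF := tayNorm T r₀ (fun ψ : (Fin d → ZMod M) → ℝ => eval H B ψ) φ with htF
  set tU := tayNorm T r₀ (fun ψ : (Fin d → ZMod M) → ℝ => eval Y B ψ) φ with htU
  set tV := tayNorm T r₀ (fun ψ : (Fin d → ZMod M) → ℝ => eval Z B ψ) φ with htV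
  have htF0 : 0 ≤ tF := tayNorm_nonneg _ _ _ _
  have htU0 : 0 ≤ tU := tayNorm_nonneg _ _ _ _
  have htV0 : 0 ≤ tV := tayNorm_nonneg _ _ _ _
  have h1 : nF ≤ Real.exp tF := tayNorm_cexp_le_exp T (contDiff_eval H B (n := r₀)) φ
  have h2 : nU ≤ tU * Real.exp tU := tayNorm_cexp_sub_one_le T (contDiff_eval Y B (n := r₀)) φ
  have h3 : nV ≤ tV * Real.exp tV := tayNorm_cexp_sub_one_le T (contDiff_eval Z B (n := r₀)) φ
  have hF1 : tF ≤ (1 + N ^ 2) * (2 * hamNorm 𝔥 R B.card H) :=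
    tayNorm_eval_le_quarter (𝕜 := ℂ) h𝔥 hR hp hBS (H := H) (r₀ := r₀) hN0 hNlin hNgrad
  have hU1 : tU ≤ (1 + N ^ 2) * (2 * a) :=
    tayNorm_eval_le_quarter (𝕜 := ℂ) h𝔥 hR hp hBS (H := Y) (r₀ := r₀) hN0 hNlin hNgrad
  have hV1 : tV ≤ (1 + N ^ 2) * (2 * b) :=
    tayNorm_eval_le_quarter (𝕜 := ℂ) h𝔥 hR hp hBS (H := Z) (r₀ := r₀) hN0 hNlin hNgrad
  have hN2 : 0 ≤ 1 + N ^ 2 := by positivity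
  have hF2 : tF ≤ (1 + N ^ 2) / 8 := by
    have := mul_le_mul_of_nonneg_left (show 2 * hamNorm 𝔥 R B.card H ≤ 2 * (1 / 16) by linarith) hN2
    linarith
  have hU2 : tU ≤ (1 + N ^ 2) / 16 := by
    have := mul_le_mul_of_nonneg_left (show 2 * a ≤ 2 * (1 / 32) by linarith) hN2
    linarith
  have hV2 : tV ≤ (1 + N ^ 2) / 16 := by
    have := mul_le_mul_of_nonneg_left (show 2 * b ≤ 2 * (1 / 32) by linarith) hN2
    linarith
  have hexp : Real.exp tF * Real.exp tU * Real.exp tV ≤ Real.exp (1 / 4) * Real.exp (N ^ 2 / 4) := by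
    rw [← Real.exp_add, ← Real.exp_add, ← Real.exp_add]
    exact Real.exp_le_exp.2 (by linarith)
  have hsq := one_add_sq_sq_le N
  have hcomb : Real.exp (N ^ 2 / 4) * Real.exp (N ^ 2 / 4) = Real.exp (N ^ 2 / 2) := by
    rw [← Real.exp_add]; ring_nf
  -- assemble
  have h2a : 0 ≤ (1 + N ^ 2) * (2 * a) := mul_nonneg hN2 (mul_nonneg zero_le_two ha0)
  have h2b : 0 ≤ (1 + N ^ 2) * (2 * b) := mul_nonneg hN2 (mul_nonneg zero_le_two hb0)
  have hab4 : 0 ≤ 4 * a * b * Real.exp (1 / 4) :=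
    mul_nonneg (mul_nonneg (mul_nonneg (by norm_num) ha0) hb0) (Real.exp_pos _).le
  have hab256 : 0 ≤ 256 * Real.exp (1 / 4) * a * b :=
    mul_nonneg (mul_nonneg (mul_nonneg (by norm_num) (Real.exp_pos _).le) ha0) hb0
  have hexp0 : 0 ≤ Real.exp tF * Real.exp tU * Real.exp tV :=
    mul_nonneg (mul_nonneg (Real.exp_pos _).le (Real.exp_pos _).le) (Real.exp_pos _).le
  have hprod : Real.exp tF * (tU * Real.exp tU) * (tV * Real.exp tV)
      ≤ 256 * Real.exp (1 / 4) * a * b * W φ := by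
    calc Real.exp tF * (tU * Real.exp tU) * (tV * Real.exp tV)
        = (tU * tV) * (Real.exp tF * Real.exp tU * Real.exp tV) := by ring
      _ ≤ (((1 + N ^ 2) * (2 * a)) * ((1 + N ^ 2) * (2 * b))) * (Real.exp (1 / 4) * Real.exp (N ^ 2 / 4)) :=
          mul_le_mul (mul_le_mul hU1 hV1 htV0 h2a) hexp hexp0 (mul_nonneg h2a h2b)
      _ = 4 * a * b * Real.exp (1 / 4) * ((1 + N ^ 2) ^ 2 * Real.exp (N ^ 2 / 4)) := by ring
      _ ≤ 4 * a * b * Real.exp (1 / 4) * (64 * Real.exp (N ^ 2 / 4) * Real.exp (N ^ 2 / 4)) := by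
          refine mul_le_mul_of_nonneg_left ?_ hab4
          exact mul_le_mul_of_nonneg_right hsq (Real.exp_pos _).le
      _ = 256 * Real.exp (1 / 4) * a * b * Real.exp (N ^ 2 / 2) := by rw [mul_assoc (64 : ℝ), hcomb]; ring
      _ ≤ 256 * Real.exp (1 / 4) * a * b * W φ := mul_le_mul_of_nonneg_left hNW hab256
  refine le_trans ?_ hprod
  have h12 : nF * nU ≤ Real.exp tF * (tU * Real.exp tU) := mul_le_mul h1 h2 hnU0 (Real.exp_pos _).le
  exact mul_le_mul h12 h3 hnV0 (mul_nonneg (Real.exp_pos _).le (mul_nonneg htU0 (Real.exp_pos _).le))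

/-- **Second differences of the Boltzmann factors**:
`‖e^{−(H+Y+Z)(B)} − e^{−(H+Y)(B)} − e^{−(H+Z)(B)} + e^{−H(B)}‖_{T, W} ≤ 256e^{1/4}‖Y‖_{k,0}‖Z‖_{k,0}` for
`‖H‖_{k,0} ≤ 1/16`, `‖Y‖_{k,0}, ‖Z‖_{k,0} ≤ 1/32`. [cite: AdamsBuchholzKoteckyMuller2019, Lemma 9.3 (9.13)] -/
theorem tayNormLE_cexp_neg_eval_secondDiff {𝔥 R : ℝ} (h𝔥 : 0 < 𝔥) (hR : 0 < R) {p : ℕ}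
    (hp : d / 2 + 1 ≤ p) {S B : Finset (Fin d → ZMod M)} (hBS : B ⊆ S)
    {W : ((Fin d → ZMod M) → ℝ) → ℝ} (hW : Ell2Dominates B 𝔥 R W) {H Y Z : RelevantHamiltonian ℂ d}
    (r₀ : ℕ) (hH : hamNorm 𝔥 R B.card H ≤ 1 / 16) (hY : hamNorm 𝔥 R B.card Y ≤ 1 / 32)
    (hZ : hamNorm 𝔥 R B.card Z ≤ 1 / 32) :
    TayNormLE (fieldGauge 𝔥 R p S) r₀ W
      (fun ψ : (Fin d → ZMod M) → ℝ => Complex.exp (-(eval (H + Y + Z) B ψ)) - Complex.exp (-(eval (H + Y) B ψ))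
        - Complex.exp (-(eval (H + Z) B ψ)) + Complex.exp (-(eval H B ψ)))
      (256 * Real.exp (1 / 4) * hamNorm 𝔥 R B.card Y * hamNorm 𝔥 R B.card Z) := by
  have hfun : (fun ψ : (Fin d → ZMod M) → ℝ => Complex.exp (-(eval (H + Y + Z) B ψ))
        - Complex.exp (-(eval (H + Y) B ψ)) - Complex.exp (-(eval (H + Z) B ψ)) + Complex.exp (-(eval H B ψ))) =
      fun ψ => Complex.exp (eval (-H + -Y + -Z) B ψ) - Complex.exp (eval (-H + -Y) B ψ)
        - Complex.exp (eval (-H + -Z) B ψ) + Complex.exp (eval (-H) B ψ) := by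
    funext ψ
    rw [show -H + -Y + -Z = -(H + Y + Z) by abel, show -H + -Y = -(H + Y) by abel,
      show -H + -Z = -(H + Z) by abel, eval_neg, eval_neg, eval_neg, eval_neg]
  rw [hfun, ← hamNorm_neg (H := Y), ← hamNorm_neg (H := Z)]
  exact tayNormLE_cexp_eval_secondDiff h𝔥 hR hp hBS hW r₀ (by rwa [hamNorm_neg]) (by rwa [hamNorm_neg])
    (by rwa [hamNorm_neg])

/-- **Second differences of `E` for the torus tower**: on the block `B = B_x` at scale `k ≤ N`, with
the strong weight `W_k^B` of [ABKM19], `‖H‖_{k,0} ≤ 1/16` and `‖Y‖_{k,0}, ‖Z‖_{k,0} ≤ 1/32` (at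
`(𝔥_k, L^k, |B|)`): `‖Σ± e^{−(H+iY+jZ)(B)}‖_{T, W_k^B} ≤ 256e^{1/4}‖Y‖_{k,0}‖Z‖_{k,0}`.
[cite: AdamsBuchholzKoteckyMuller2019, Lemma 9.3 (9.13)] -/
theorem tayNormLE_expNegH_secondDiff_strong_abkm {L N Mord R k p : ℕ} {h : ℝ} (hd : 2 ≤ d) (hLodd : Odd L)
    (hM : M = L ^ N) (hk : k ≤ N) (hh : 0 < h) (hMord : d / 2 + 1 ≤ Mord) (hp : d / 2 + 1 ≤ p)
    {x : Fin d → ZMod M} {S : Finset (Fin d → ZMod M)} (hBS : blockOf (L ^ k) x ⊆ S)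
    {H Y Z : RelevantHamiltonian ℂ d} (r₀ : ℕ)
    (hH : hamNorm (fieldWt h (L : ℝ) d k) ((L : ℝ) ^ k) (blockOf (L ^ k) x).card H ≤ 1 / 16)
    (hY : hamNorm (fieldWt h (L : ℝ) d k) ((L : ℝ) ^ k) (blockOf (L ^ k) x).card Y ≤ 1 / 32)
    (hZ : hamNorm (fieldWt h (L : ℝ) d k) ((L : ℝ) ^ k) (blockOf (L ^ k) x).card Z ≤ 1 / 32) :
    TayNormLE (fieldGauge (fieldWt h (L : ℝ) d k) ((L : ℝ) ^ k) p S) r₀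
      (expWeight (strongCoef h N k • derivForm (L : ℝ) k (diffIndex d Mord)
        (boxDensity (boxRad R L k) (boxWt (L : ℝ) d k) (blockOf (L ^ k) x))))
      (fun ψ : (Fin d → ZMod M) → ℝ => expNegH (H + Y + Z) (blockOf (L ^ k) x) ψ
        - expNegH (H + Y) (blockOf (L ^ k) x) ψ - expNegH (H + Z) (blockOf (L ^ k) x) ψ
        + expNegH H (blockOf (L ^ k) x) ψ)
      (256 * Real.exp (1 / 4) * hamNorm (fieldWt h (L : ℝ) d k) ((L : ℝ) ^ k) (blockOf (L ^ k) x).card Y *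
        hamNorm (fieldWt h (L : ℝ) d k) ((L : ℝ) ^ k) (blockOf (L ^ k) x).card Z) := by
  have hL0 : (0 : ℝ) < L := by exact_mod_cast hLodd.pos
  exact tayNormLE_cexp_neg_eval_secondDiff (fieldWt_pos hh hL0 d k) (by positivity) hp hBS
    (ell2Dominates_strongWeight_abkm (R := R) hd hLodd hM hk hh hMord x) r₀ hH hY hZ

end Literature.MathematicalPhysics.StatisticalMechanics.GradientRG

end
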